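import Literature.MathematicalPhysics.QuantumFieldTheory.Balaban1983to89.B5Prop12G0DiagTorus

/-!
# `Balaban1983to89.B5Local114SixthTorus` — the sixth member ‖ζG₀∇*∇*T‖ of (1.114) for the diagonal G₀ BY DUALITY from
# the fifth member ‖ζ′∇∇G₀A‖: (1.114) for G₀ on 1-forms, and Proposition 1.2 for G₀ on the torus, from (1.114) for the
# per-direction scalar members ALONE

statement-level skeleton of published theorems with citation tags; proofs where landed; nothing here is a claim
about the Yang–Mills mass gap

Source (lit-balaban / pub-balaban cells): T. Bałaban, *Propagators and renormalization transformations for lattice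
gauge theories. I*, Commun. Math. Phys. **95** (1984) 17–40 [`Balaban1984PropagatorsI`, "B5"], pp. 35–36 [PDF 19–20]
(Prop. 1.2 (1.114)), p. 39 [PDF 23] ((1.132)–(1.134)); held as `paper:balaban1984-cmp95-propagators-rt-i`.

## WHAT IS PRINTED (verbatim, p. 36 and p. 39)

(1.114): «‖ζGJ‖, ‖ζ∇GJ‖, ‖ζG∇*J‖, ‖ζ∇G∇*J‖, ‖ζ∇∇GJ‖, ‖ζG∇*∇*J‖ ≤ O(1)e^{−δ₀|y−y′|}|ζ|‖J‖ for supp ζ ⊂ Δ̃(y),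
supp J ⊂ Δ̃(y′).»  p. 39: «G₀ … is symmetric … This leads also to (1.114) by the same reasoning … as for G.»

## WHAT THIS MODULE PROVES (kernel-checked, zero sorry)

G₀^{(μ)} is symmetric (`B5Eq133G0Torus.G0_isSymm`) and ∂* is the transpose of ∂ (U = 1), so
⟨ζ·G₀∇*∇*T, u⟩ = Σ ⟨T_{(νν′)μ}, ∂_{ν′}∂_νG₀^{(μ)}u_μ⟩ (`dual_identity`); with u = ζ·(ζG₀∇*∇*T), the support of T inside
Δ̃(y′) (cut-off 1_{Δ̃(y′)}) and Cauchy–Schwarz this bounds the SIXTH member of (1.114) at (ζ, T, y, y′) by the FIFTH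
member (index 4: ‖1_{Δ̃(y′)}∇∇G₀u‖) at the swapped pair (y′, y): `sixth_le_of_fourth`.  Hence, for the diagonal family
`B5G0DiagTorus.famDiag` (P.d = d), **`sixth_of_scalar`**: (1.114) for the scalar members (torus, μ) ⇒ the sixth member
(`B5Prop12G0DiagTorus.Local114SixthFam`), so **`local114Diag_of_scalar`**: Local114Fam (scalar family) ⇒ Local114Fam
(diagonal family) with NO sixth-member hypothesis, `local114DiagTop_of_scalarTop`, and the final capstone
**`prop12DiagTop_of_local114G0 (h114G0 : Local114Fam (famG0Top d L a 0)) : Prop12Printed (famDiagTop d L a 0)`** —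
Proposition 1.2 for Bałaban's G₀ on 1-forms of every torus from (1.114) for the per-direction scalar G₀-settings ALONE
(members ‖ζG₀J‖ … ‖ζ∇∇G₀J‖; their sixth member is vacuous by construction).
HONEST SCOPE: U = 1 (∂* = ∂ᵀ); tori of `Setup`; constants (d + 1)·C, not optimised; m² ≥ 0 arbitrary for the (1.114)
statements, m² = 0 for the capstone.  CELL BOOK-KEEPING: row B5.Prop1.2 census (vi)/(vii) glue (owner r02, (vi)-G₀ worker
p38); VALUE = bookkeeping (one adjointness identity), NOT summit progress.
-/

namespace Literature.MathematicalPhysics.QuantumFieldTheory.Balaban1983to89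

open Matrix

noncomputable section

namespace B5Local114SixthTorus

open B1RG242Torus B5Ineq137Torus B5GpSettingTorus B5Eq133G0Torus B5G0SettingTorus B5FromB4 B5G0DiagTorus
  B5TowerSourcesG0 B5Pieces133Torus B5Prop12G0DiagTorus
open B5Prop11G0Tower (l2Fam_le_of_sq)

variable {P : Params}

/-! ## §1 Adjointness and the duality identity -/

/-- ⟨Mᵀv, w⟩ = ⟨v, Mw⟩. [folklore] -/
private theorem trMulVec_dot {S : Type} [Fintype S] (M : Matrix S S ℝ) (v w : S → ℝ) :
    (Mᵀ *ᵥ v) ⬝ᵥ w = v ⬝ᵥ (M *ᵥ w) := by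
  rw [dotProduct_comm, Matrix.dotProduct_mulVec, Matrix.vecMul_transpose, dotProduct_comm]

/-- The weight η^d ≥ 0. [folklore] -/
private theorem w_nonneg (k : ℕ) : 0 ≤ (((P.L : ℝ) ^ k)⁻¹) ^ P.d := by positivity

section OneTorus

variable {a msq : ℝ} {k : ℕ}

/-- **THE DUALITY IDENTITY**: Σ_x (G₀∇*∇*T)_μ(x)·u_μ(x) = Σ_{(ν,ν′)} Σ_x T_{(νν′)μ}(x)·(∂_{ν′}∂_νG₀^{(μ)}u_μ)(x)
(G₀^{(μ)} symmetric, ∂* = ∂ᵀ). [cite: Balaban1984PropagatorsI, (1.114) p.36, p.39 («G₀ … is diagonal in vector indices»)] -/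
theorem dual_identity (T : Fin P.d × Fin P.d → Fin P.d → Site P 0 → ℝ) (u : Fin P.d → Site P 0 → ℝ) (μ : Fin P.d) :
    ∑ x, dDiv2 P a msq k T μ x * u μ x =
      ∑ p : Fin P.d × Fin P.d, ∑ x, T p μ x * dKD2 P a msq k u ((p.2, p.1), μ) x := by
  have hG : (G0 P a msq k μ)ᵀ = G0 P a msq k μ := (G0_isSymm a msq k μ).eq
  set S : Site P 0 → ℝ := ∑ p : Fin P.d × Fin P.d, (dEta P k p.1)ᵀ *ᵥ ((dEta P k p.2)ᵀ *ᵥ T p μ) with hS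
  have h1 : ∑ x, dDiv2 P a msq k T μ x * u μ x = (G0 P a msq k μ *ᵥ S) ⬝ᵥ u μ := rfl
  rw [h1, ← hG, trMulVec_dot, hS, dotProduct_comm, dotProduct_sum]
  refine Finset.sum_congr rfl fun p _ => ?_
  rw [dotProduct_comm, trMulVec_dot, trMulVec_dot, Matrix.mulVec_mulVec, Matrix.mulVec_mulVec]
  rfl

/-- Inserting the cut-off 1_{Δ̃(y′)} against a source supported in Δ̃(y′). [cite: Balaban1984PropagatorsI, (1.114) p.36] -/
theorem mul_cubeInd_of_supp {y' : Site P k} {t e : ℝ} {x : Site P 0} (ht : t ≠ 0 → inCube P k x y') :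
    t * e = t * (cubeInd P k y' x * e) := by
  by_cases h : t = 0
  · simp [h]
  · rw [cubeInd, if_pos (ht h), one_mul]

/-- ‖ζ·v‖ ≤ |ζ|·‖v‖. [cite: Balaban1984PropagatorsI, (1.114) p.36; bookkeeping] -/
theorem l2Fam_cut_le {ι : Type} [Fintype ι] (ζ : Site P 0 → ℝ) (v : ι → Site P 0 → ℝ) :
    l2Fam P k (fun i x => ζ x * v i x) ≤ supN P ζ * l2Fam P k v := by
  refine l2Fam_le_of_sq P k _ _ (supN_nonneg P ζ) ?_
  rw [Finset.mul_sum]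
  refine Finset.sum_le_sum fun i _ => ?_
  rw [Finset.mul_sum]
  refine Finset.sum_le_sum fun x _ => ?_
  have h1 : ζ x ^ 2 ≤ supN P ζ ^ 2 := by
    rw [← sq_abs (ζ x)]
    exact pow_le_pow_left₀ (abs_nonneg _) (le_supN P ζ x) 2
  rw [mul_pow]
  exact mul_le_mul_of_nonneg_right h1 (sq_nonneg _)

/-- **THE SIXTH MEMBER FROM THE FIFTH BY DUALITY, one torus**: if ‖χ∇∇G₀u‖ ≤ C e^{−δ₀|y′−y|}|χ|‖u‖ for all cut-offs χ with
supp χ ⊂ Δ̃(y′) and vector sources u with supp u ⊂ Δ̃(y) (the member of index 4 at the swapped pair), then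
‖ζG₀∇*∇*T‖ ≤ C e^{−δ₀|y−y′|}|ζ|‖T‖ for supp ζ ⊂ Δ̃(y), supp T ⊂ Δ̃(y′). [cite: Balaban1984PropagatorsI, (1.114) p.36, p.39] -/
theorem sixth_le_of_fourth {C δ₀ : ℝ} (hC : 0 ≤ C) (y y' : Site P k) (ζ : Site P 0 → ℝ)
    (hζ : ∀ x, ζ x ≠ 0 → inCube P k x y) (T' : Fin P.d × Fin P.d → Fin P.d → Site P 0 → ℝ)
    (hT : ∀ p μ x, T' p μ x ≠ 0 → inCube P k x y')
    (h4 : ∀ (u : Fin P.d → Site P 0 → ℝ) (χ : Site P 0 → ℝ), (∀ x, χ x ≠ 0 → inCube P k x y') →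
      (∀ μ x, u μ x ≠ 0 → inCube P k x y) →
        (g0Diag P a msq k).l2loc 4 (.vec u) χ ≤ C * Real.exp (-(δ₀ * T P k y' y)) * supN P χ * l2Fam P k u) :
    (g0Diag P a msq k).l2loc 5 (.ten2 T') ζ ≤
      C * Real.exp (-(δ₀ * T P k y y')) * supN P ζ * l2Fam P k (fun p : (Fin P.d × Fin P.d) × Fin P.d => T' p.1 p.2) := by
  -- names
  set w : ℝ := (((P.L : ℝ) ^ k)⁻¹) ^ P.d with hw
  have hw0 : 0 ≤ w := w_nonneg k
  set v : Fin P.d → Site P 0 → ℝ := fun μ x => ζ x * dDiv2 P a msq k T' μ x with hv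
  set u : Fin P.d → Site P 0 → ℝ := fun μ x => ζ x * v μ x with hu
  set χ : Site P 0 → ℝ := cubeInd P k y' with hχ
  set N := l2Fam P k v with hN
  set NT := l2Fam P k (fun p : (Fin P.d × Fin P.d) × Fin P.d => T' p.1 p.2) with hNT
  set M4 := l2Fam P k (fun (q : (Fin P.d × Fin P.d) × Fin P.d) x => χ x * dKD2 P a msq k u q x) with hM4
  show N ≤ C * Real.exp (-(δ₀ * T P k y y')) * supN P ζ * NT
  have hN0 : 0 ≤ N := l2Fam_nonneg (P := P) k v
  have hNT0 : 0 ≤ NT := l2Fam_nonneg (P := P) k _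
  have hz : 0 ≤ supN P ζ := supN_nonneg P ζ
  have hE : 0 ≤ Real.exp (-(δ₀ * T P k y y')) := (Real.exp_pos _).le
  -- supports of u and χ
  have hu_supp : ∀ μ x, u μ x ≠ 0 → inCube P k x y := by
    intro μ x h
    have hz' : ζ x ≠ 0 := fun h0 => h (by rw [hu]; simp [h0])
    exact hζ x hz'
  have hχ_supp : ∀ x, χ x ≠ 0 → inCube P k x y' := fun x h => cubeInd_ne_zero h
  -- Step 1: N² = w · Σ_μ Σ_x (G₀∇*∇*T)_μ · u_μ
  have step1 : N ^ 2 = w * ∑ μ, ∑ x, dDiv2 P a msq k T' μ x * u μ x := by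
    rw [hN, l2Fam, Real.sq_sqrt (Finset.sum_nonneg fun μ _ => Finset.sum_nonneg fun x _ =>
      mul_nonneg hw0 (sq_nonneg _)), Finset.mul_sum]
    refine Finset.sum_congr rfl fun μ _ => ?_
    rw [Finset.mul_sum]
    refine Finset.sum_congr rfl fun x _ => ?_
    rw [hu, hv]; ring
  -- Step 2: duality and the cut-off of Δ̃(y′)
  have step2 : ∑ μ, ∑ x, dDiv2 P a msq k T' μ x * u μ x =
      ∑ μ, ∑ p : Fin P.d × Fin P.d, ∑ x, T' p μ x * (χ x * dKD2 P a msq k u ((p.2, p.1), μ) x) := by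
    refine Finset.sum_congr rfl fun μ _ => ?_
    rw [dual_identity]
    refine Finset.sum_congr rfl fun p _ => Finset.sum_congr rfl fun x _ => ?_
    exact mul_cubeInd_of_supp (hT p μ x)
  -- Step 3: Cauchy–Schwarz on the flattened index
  set f : ((Fin P.d × Fin P.d) × Fin P.d) × Site P 0 → ℝ := fun q => T' q.1.1 q.1.2 q.2 with hf
  set g : ((Fin P.d × Fin P.d) × Fin P.d) × Site P 0 → ℝ :=
    fun q => χ q.2 * dKD2 P a msq k u ((q.1.1.2, q.1.1.1), q.1.2) q.2 with hg
  have step3 : ∑ μ, ∑ p : Fin P.d × Fin P.d, ∑ x, T' p μ x * (χ x * dKD2 P a msq k u ((p.2, p.1), μ) x) =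
      ∑ q, f q * g q := by
    rw [Fintype.sum_prod_type, Fintype.sum_prod_type, Finset.sum_comm]
  have hff : ∑ q, f q ^ 2 = ∑ p : (Fin P.d × Fin P.d) × Fin P.d, ∑ x, T' p.1 p.2 x ^ 2 := by
    rw [Fintype.sum_prod_type]
  -- the g-sum is the fifth member at (u, χ) after the swap (ν,ν′) ↦ (ν′,ν)
  let σ : (Fin P.d × Fin P.d) × Fin P.d ≃ (Fin P.d × Fin P.d) × Fin P.d :=
    (Equiv.prodComm (Fin P.d) (Fin P.d)).prodCongr (Equiv.refl (Fin P.d))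
  have hgg : ∑ q, g q ^ 2 = ∑ q : (Fin P.d × Fin P.d) × Fin P.d, ∑ x, (χ x * dKD2 P a msq k u q x) ^ 2 := by
    rw [Fintype.sum_prod_type]
    exact Fintype.sum_equiv σ _ _ fun q => rfl
  have hNT2 : NT ^ 2 = w * ∑ q, f q ^ 2 := by
    rw [hff, hNT, l2Fam, Real.sq_sqrt (Finset.sum_nonneg fun _ _ => Finset.sum_nonneg fun x _ =>
      mul_nonneg hw0 (sq_nonneg _)), Finset.mul_sum]
    exact Finset.sum_congr rfl fun _ _ => by rw [Finset.mul_sum]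
  have hM42 : M4 ^ 2 = w * ∑ q, g q ^ 2 := by
    rw [hgg, hM4, l2Fam, Real.sq_sqrt (Finset.sum_nonneg fun _ _ => Finset.sum_nonneg fun x _ =>
      mul_nonneg hw0 (sq_nonneg _)), Finset.mul_sum]
    exact Finset.sum_congr rfl fun _ _ => by rw [Finset.mul_sum]
  have hM40 : 0 ≤ M4 := l2Fam_nonneg (P := P) k _
  have hCS : N ^ 2 ≤ NT * M4 := by
    have hpos : 0 ≤ w * ∑ q, f q * g q := by rw [← step3, ← step2, ← step1]; positivity
    have h := Finset.sum_mul_sq_le_sq_mul_sq Finset.univ f g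
    have h2 : (w * ∑ q, f q * g q) ^ 2 ≤ (NT * M4) ^ 2 :=
      calc (w * ∑ q, f q * g q) ^ 2 = w ^ 2 * (∑ q, f q * g q) ^ 2 := mul_pow _ _ _
        _ ≤ w ^ 2 * ((∑ q, f q ^ 2) * ∑ q, g q ^ 2) := mul_le_mul_of_nonneg_left h (sq_nonneg w)
        _ = (w * ∑ q, f q ^ 2) * (w * ∑ q, g q ^ 2) := by ring
        _ = (NT * M4) ^ 2 := by rw [← hNT2, ← hM42]; ring
    rw [step1, step2, step3]
    exact (pow_le_pow_iff_left₀ hpos (mul_nonneg hNT0 hM40) two_ne_zero).mp h2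
  -- Step 4: the fifth member at (u, χ), swapped pair; |χ| ≤ 1, ‖u‖ ≤ |ζ|·N
  have h4' : M4 ≤ C * Real.exp (-(δ₀ * T P k y' y)) * supN P χ * l2Fam P k u := by
    have h := h4 u χ hχ_supp hu_supp
    change M4 ≤ _ at h
    exact h
  have hχ1 : supN P χ ≤ 1 := supN_cubeInd_le k y'
  have hul : l2Fam P k u ≤ supN P ζ * N := l2Fam_cut_le ζ v
  have hM4_le : M4 ≤ C * Real.exp (-(δ₀ * T P k y y')) * supN P ζ * N := by
    rw [T_symm] at h4'
    refine h4'.trans ?_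
    calc C * Real.exp (-(δ₀ * T P k y y')) * supN P χ * l2Fam P k u
        ≤ C * Real.exp (-(δ₀ * T P k y y')) * 1 * (supN P ζ * N) :=
          mul_le_mul (mul_le_mul_of_nonneg_left hχ1 (mul_nonneg hC hE)) hul (l2Fam_nonneg (P := P) k u)
            (by positivity)
      _ = C * Real.exp (-(δ₀ * T P k y y')) * supN P ζ * N := by ring
  -- Step 5: N² ≤ NT·(B·N) ⇒ N ≤ B·NT
  have hB0 : 0 ≤ C * Real.exp (-(δ₀ * T P k y y')) * supN P ζ * NT :=
    mul_nonneg (mul_nonneg (mul_nonneg hC hE) hz) hNT0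
  by_cases hNz : N = 0
  · rw [hNz]; exact hB0
  have hNpos : 0 < N := lt_of_le_of_ne hN0 (Ne.symm hNz)
  have hNN : N * N ≤ (C * Real.exp (-(δ₀ * T P k y y')) * supN P ζ * NT) * N := by
    calc N * N = N ^ 2 := (sq N).symm
      _ ≤ NT * M4 := hCS
      _ ≤ NT * (C * Real.exp (-(δ₀ * T P k y y')) * supN P ζ * N) := mul_le_mul_of_nonneg_left hM4_le hNT0
      _ = (C * Real.exp (-(δ₀ * T P k y y')) * supN P ζ * NT) * N := by ring
  exact le_of_mul_le_mul_right hNN hNpos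

end OneTorus

/-! ## §2 The families: (1.114) for G₀ on 1-forms, and Prop. 1.2, from the scalar members alone -/

section Families

variable {I : Type} (Pf : I → Params) (a msq : ℝ)

/-- **THE SIXTH MEMBER FOR THE DIAGONAL FAMILY from (1.114) for the scalar members (torus, μ)** (P.d = d): by duality
from the fifth member, which is a sum over μ of scalar members at single-component sources; constant (d + 1)·C.
[cite: Balaban1984PropagatorsI, (1.114) p.36, (1.132) p.39] -/
theorem sixth_of_scalar {d : ℕ} (hPd : ∀ i, (Pf i).d = d) (hS : B5.Local114Fam (famScalar Pf a msq)) :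
    Local114SixthFam (famDiag Pf a msq) := by
  obtain ⟨δ₀, C, hδ₀, hC, hS⟩ := hS
  refine ⟨δ₀, (d + 1) * C, hδ₀, by positivity, ?_⟩
  intro i J ζ y y' hζ hJ
  change LocT (Pf i) at J
  change Site (Pf i) 0 → ℝ at ζ
  change Site (Pf i) (Pf i).K at y y'
  have hz : 0 ≤ supN (Pf i) ζ := supN_nonneg _ ζ
  have hE : 0 ≤ Real.exp (-(δ₀ * T (Pf i) (Pf i).K y y')) := (Real.exp_pos _).le
  have hdC : (0 : ℝ) ≤ (d + 1) * C := by positivity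
  cases J with
  | vec A =>
    show (0 : ℝ) ≤ (d + 1) * C * Real.exp (-(δ₀ * T (Pf i) (Pf i).K y y')) * supN (Pf i) ζ * l2Fam (Pf i) (Pf i).K A
    exact mul_nonneg (mul_nonneg (mul_nonneg hdC hE) hz) (l2Fam_nonneg (P := Pf i) _ A)
  | ten T' =>
    show (0 : ℝ) ≤ (d + 1) * C * Real.exp (-(δ₀ * T (Pf i) (Pf i).K y y')) * supN (Pf i) ζ *
      l2Fam (Pf i) (Pf i).K (fun p : Fin (Pf i).d × Fin (Pf i).d => T' p.1 p.2)
    exact mul_nonneg (mul_nonneg (mul_nonneg hdC hE) hz) (l2Fam_nonneg (P := Pf i) _ _)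
  | ten2 T' =>
    have hT : ∀ p μ x, T' p μ x ≠ 0 → inCube (Pf i) (Pf i).K x y' := hJ
    have hζ' : ∀ x, ζ x ≠ 0 → inCube (Pf i) (Pf i).K x y := hζ
    show (g0Diag (Pf i) a msq (Pf i).K).l2loc 5 (.ten2 T') ζ ≤ (d + 1) * C * Real.exp (-(δ₀ * T (Pf i) (Pf i).K y y')) *
      supN (Pf i) ζ * l2Fam (Pf i) (Pf i).K (fun p : (Fin (Pf i).d × Fin (Pf i).d) × Fin (Pf i).d => T' p.1 p.2)
    refine sixth_le_of_fourth hdC y y' ζ hζ' T' hT ?_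
    intro u χ hχ hu
    have hχ0 : 0 ≤ supN (Pf i) χ := supN_nonneg _ χ
    have hE' : 0 ≤ Real.exp (-(δ₀ * T (Pf i) (Pf i).K y' y)) := (Real.exp_pos _).le
    have hnu : 0 ≤ l2Fam (Pf i) (Pf i).K u := l2Fam_nonneg (P := Pf i) _ u
    have hsl : ∀ μ : Fin (Pf i).d, (g0Setting (Pf i) a msq (Pf i).K μ).l2loc 4 (slot u μ μ) χ ≤
        C * Real.exp (-(δ₀ * T (Pf i) (Pf i).K y' y)) * supN (Pf i) χ * l2Fam (Pf i) (Pf i).K u := by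
      intro μ
      have h : (g0Setting (Pf i) a msq (Pf i).K μ).l2loc 4 (slot u μ μ) χ ≤
          C * Real.exp (-(δ₀ * T (Pf i) (Pf i).K y' y)) * supN (Pf i) χ * l2NormV (Pf i) (Pf i).K (slot u μ μ) :=
        hS ⟨i, μ⟩ 4 (slot u μ μ) χ y' y hχ (suppIn_slot hu μ μ)
      rw [l2NormV_eq_l2Fam] at h
      exact h.trans (mul_le_mul_of_nonneg_left (l2Fam_slot_le u μ μ) (mul_nonneg (mul_nonneg hC.le hE') hχ0))
    have hdd : ((Pf i).d : ℝ) = d := by exact_mod_cast hPd i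
    have h0 : 0 ≤ C * Real.exp (-(δ₀ * T (Pf i) (Pf i).K y' y)) * supN (Pf i) χ * l2Fam (Pf i) (Pf i).K u :=
      mul_nonneg (mul_nonneg (mul_nonneg hC.le hE') hχ0) hnu
    calc (g0Diag (Pf i) a msq (Pf i).K).l2loc 4 (.vec u) χ
        ≤ ∑ μ, (g0Setting (Pf i) a msq (Pf i).K μ).l2loc 4 (slot u μ μ) χ := diag_l2loc4_le u χ
      _ ≤ ∑ _μ : Fin (Pf i).d, C * Real.exp (-(δ₀ * T (Pf i) (Pf i).K y' y)) * supN (Pf i) χ * l2Fam (Pf i) (Pf i).K u :=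
          Finset.sum_le_sum fun μ _ => hsl μ
      _ = ((Pf i).d : ℝ) * (C * Real.exp (-(δ₀ * T (Pf i) (Pf i).K y' y)) * supN (Pf i) χ * l2Fam (Pf i) (Pf i).K u) := by
          rw [Finset.sum_const, Finset.card_univ, Fintype.card_fin, nsmul_eq_mul]
      _ ≤ (d + 1) * C * Real.exp (-(δ₀ * T (Pf i) (Pf i).K y' y)) * supN (Pf i) χ * l2Fam (Pf i) (Pf i).K u := by
          rw [hdd]; nlinarith

/-- **(1.114) FOR G₀ ON 1-FORMS from (1.114) for the scalar members alone** (P.d = d; no sixth-member hypothesis).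
[cite: Balaban1984PropagatorsI, (1.114) p.36, (1.132) p.39] -/
theorem local114Diag_of_scalar {d : ℕ} (hPd : ∀ i, (Pf i).d = d) (hS : B5.Local114Fam (famScalar Pf a msq)) :
    B5.Local114Fam (famDiag Pf a msq) :=
  local114_diag_of_scalar Pf a msq hPd hS (sixth_of_scalar Pf a msq hPd hS)

end Families

section Top

variable (d L : ℕ)

/-- **(1.114) for the diagonal family of record from (1.114) for the scalar family of record `famG0Top` alone.**
[cite: Balaban1984PropagatorsI, (1.114) p.36, (1.132) p.39] -/
theorem local114DiagTop_of_scalarTop (a msq : ℝ) (hS : B5.Local114Fam (famG0Top d L a msq)) :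
    B5.Local114Fam (famDiagTop d L a msq) := by
  have hS' : B5.Local114Fam (famScalar (fun i : B5ResidualGpTorusHolds.TopIdx d L => i.P) a msq) :=
    local114_reindex _ (fun j : (Σ i : B5ResidualGpTorusHolds.TopIdx d L, Fin i.P.d) =>
      (⟨j.1.P, j.1.hPd, j.1.hPL, j.1.hK, j.2⟩ : G0TopIdx d L)) hS
  exact local114Diag_of_scalar _ a msq (fun i => i.hPd) hS'

/-- **PROPOSITION 1.2 FOR BAŁABAN'S G₀ ON 1-FORMS OF EVERY TORUS FROM (1.114) FOR THE SCALAR G₀-SETTINGS ALONE** (m² = 0):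
the one remaining printed input of the whole G₀ block is «This leads also to (1.114) …» for the per-direction scalar
settings `B5G0SettingTorus.famG0Top d L a 0` (members ‖ζG₀J‖, …, ‖ζ∇∇G₀J‖).
[cite: Balaban1984PropagatorsI, Prop. 1.2 (1.110)–(1.114) pp.35–36, (1.132)–(1.134) p.39] -/
theorem prop12DiagTop_of_local114G0 (hd : 1 ≤ d) (hL : Odd L ∧ 1 < L) {a : ℝ} (ha : 0 < a)
    (h114G0 : B5.Local114Fam (famG0Top d L a 0)) : B5.Prop12Printed (famDiagTop d L a 0) :=
  prop12DiagTop_of_local114 d L hd hL ha (local114DiagTop_of_scalarTop d L a 0 h114G0)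

end Top

end B5Local114SixthTorus

end

end Literature.MathematicalPhysics.QuantumFieldTheory.Balaban1983to89
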